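import Summits.MatrixMultiplication.MatrixMultiplication.Theorems.SaturationLadderTwinDefect
import HarnessLib

/-!
# SaturationLadder — the in-class ceiling of the STAGE-2 twin method: mass bound `(C1)` and ceiling inequality `(C2)`

Route `SaturationLadder` (sub-problem `MatrixMultiplication`), crux `SubexpSaturation`
(stmt-MatrixMultiplication-25909).  STAGE 2 of the cell's ceiling programme (BC9: «every rung a theorem
AND the ceiling a theorem») for the twin class `SaturationLadderTwinExact.omegaRect_one_tw_exact`
(`ω(1, t, r) ≤ 1 + r` at `t = j n₁/((j+1) n₃ + n₅)`, `r = ((j+1) n₂ + n₁ + n₄)/((j+1) n₃ + n₅)`,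
`n₁ + n₄ + n₅ = 2 n₆`, `n₂ + n₃ = 2^{j+1} n₆`, two marginal-entropy hypotheses).  STAGE 1
(`SaturationLadderTwinDefect`) turned the two entropy hypotheses into the DEFECT INEQUALITIES `(Y*)`, `(X*)`
and proved the asymptotic `core` inequality with constant `c₂ = (5 log(5/4) + 3 log 2)/3 = log (3125/128)^{1/3}`.
Here, in the normalisation `n₆ = 1` (real atoms `n₁, n₃, n₄, n₅ ≥ 0`, `n₁ + n₄ + n₅ = 2`, level `j`,
`B = 2^{j+1}`, `n₂ = B − n₃`):

* §1 `(C1)` MASS LOWER BOUND (`mass_lower`): `(Y*)` and `(X*)` force `(j+1)(n₃ − n₁) + n₁ + n₅ ≥ 1/4` for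
  every member with `j ≥ 1` — the numerator of `1 − t = ((j+1)(n₃ − n₁) + n₁ + n₅)/((j+1) n₃ + n₅)` is
  bounded below uniformly in `j` (numerically the infimum is `≈ 2.5`; `1/4` suffices).  Proof: the tangent
  bound `a log a ≥ a − 1`, the global bound `x log x ≥ −3/8 > −1/e`, and a convex combination in `n₄ ∈ [0,2]`
  of two explicit quadratic polynomials in `J = j+1` (`massPoly_two`, `massPoly_zero`), nonnegative for
  `J ≥ 2` by interval arithmetic on `log 2`.
* §2 `(C2)` CEILING INEQUALITY (`ceiling_ineq`): for every member with `j ≥ 3` in the regime `t ≥ 1/2`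
  (`(j+1) n₃ + n₅ ≤ 2 j n₁`):  `(1 − t) · log r ≥ c₂ − 320/(j+1)`.  Proof: write `1 − t = M/D`,
  `D = (j+1) n₃ + n₅`, `log r ≥ (j+1) log 2 + 1 − σ` with `σ = 1 + log 2 + log(D/(j+1)) ∈ [0, 37/10]`
  (`D/(j+1) ∈ [43/100, 4]`), feed `(Y*)`, `(X*)` with slack `ε = (3/4 + 2 log 2)/(j log 2 + log 2 + 1)` into
  `core`, and absorb all `O(1)` terms into the explicit constant `320` using `(C1)`-type bounds
  (`M ≥ 1/4`, `D ≥ 43(j+1)/100`).  The constant is generous; only `K/(j+1) → 0` matters.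

Consequence (next file, `SaturationLadderTwinClassNoBase`): no in-class `Base(θ)` witness exists for
`1 < θ < (3125/128)^{1/3}`, so together with `SaturationLadderTwinEndpoint.base_of_cube_ge` the exact ceiling
of the twin method on the `Base` ladder of `SubexpSaturation` is `θ_c = (3125/128)^{1/3}`; the crux below
`θ_c` needs a new class (cell tags: IDEA-NEEDED).  No definitions, no named facts, no sorry.
[cite: CoppersmithWinograd1990, §8] [cite: AlmanDuanVassilevskaWilliamsXuXuZhou2025, §3.4]
-/

set_option linter.dupNamespace false
-- (single-conjunct summit: the namespace repeats `MatrixMultiplication`)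

noncomputable section

namespace Summit.MatrixMultiplication.MatrixMultiplication.Theorems.SaturationLadderTwinClassCeiling

open Literature.Computability.AlgebraicComplexity
open Summit.MatrixMultiplication.MatrixMultiplication.Theorems.SaturationLadderTwinDefect
  (mul_log_tangent core)

/-! ### §1  Mass lower bound `(C1)`: `(j+1)(n₃ − n₁) + n₁ + n₅ ≥ 1/4` for every member, `j ≥ 1` -/

/-- `x log x ≥ −3/8` for `x ≥ 0` (tangent at `e⁻¹`, and `e⁻¹ < 3/8`). [folklore] -/
theorem mul_log_ge_neg {x : ℝ} (hx : 0 ≤ x) : -(3 / 8 : ℝ) ≤ x * Real.log x := by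
  have h1 := mul_log_tangent (Real.exp_pos (-1)) hx
  rw [Real.log_exp] at h1
  have h2 := Real.exp_neg_one_lt_d9
  nlinarith [h1, h2, Real.exp_pos (-1)]

/-- Endpoint polynomial at `n₄ = 2` for `mass_lower`: nonnegative for `J ≥ 2`. [folklore] -/
theorem massPoly_two {J ℓ : ℝ} (hJ : 2 ≤ J) (hl : 0.6931471803 < ℓ) (hl' : ℓ < 0.6931471808) :
    0 ≤ J * (J * ℓ + 1) * (21 / 8 - 2 * ℓ) - J * (3 / 4 + 2 * ℓ) - 1 / 4 * (J * ℓ + 1) ^ 2 := by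
  have hJ0 : 0 ≤ J := by linarith
  have hx : 0 ≤ J - 2 := by linarith
  have hc2 : (0.738 : ℝ) ≤ 21 * ℓ / 8 - 9 * ℓ ^ 2 / 4 := by nlinarith
  have hc1 : (-1.2443 : ℝ) ≤ 15 / 8 - 9 * ℓ / 2 := by linarith
  have e : J * (J * ℓ + 1) * (21 / 8 - 2 * ℓ) - J * (3 / 4 + 2 * ℓ) - 1 / 4 * (J * ℓ + 1) ^ 2 =
      J ^ 2 * (21 * ℓ / 8 - 9 * ℓ ^ 2 / 4) + J * (15 / 8 - 9 * ℓ / 2) - 1 / 4 := by ring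
  rw [e]
  nlinarith [mul_le_mul_of_nonneg_left hc2 (sq_nonneg J), mul_le_mul_of_nonneg_left hc1 hJ0,
    mul_nonneg hx hx]

/-- Endpoint polynomial at `n₄ = 0` for `mass_lower`: nonnegative for `J ≥ 2`. [folklore] -/
theorem massPoly_zero {J ℓ : ℝ} (hJ : 2 ≤ J) (hl : 0.6931471803 < ℓ) (hl' : ℓ < 0.6931471808) :
    0 ≤ J * (J * ℓ + 1) * (5 / 8 - 2 * ℓ) - J * (3 / 4 + 2 * ℓ) + 7 / 4 * (J * ℓ + 1) ^ 2 := by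
  have hJ0 : 0 ≤ J := by linarith
  have hx : 0 ≤ J - 2 := by linarith
  have hd2 : (0.313 : ℝ) ≤ 5 * ℓ / 8 - ℓ ^ 2 / 4 := by nlinarith
  have hd1 : (-0.4716 : ℝ) ≤ -1 / 8 - ℓ / 2 := by linarith
  have e : J * (J * ℓ + 1) * (5 / 8 - 2 * ℓ) - J * (3 / 4 + 2 * ℓ) + 7 / 4 * (J * ℓ + 1) ^ 2 =
      J ^ 2 * (5 * ℓ / 8 - ℓ ^ 2 / 4) + J * (-1 / 8 - ℓ / 2) + 7 / 4 := by ring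
  rw [e]
  nlinarith [mul_le_mul_of_nonneg_left hd2 (sq_nonneg J), mul_le_mul_of_nonneg_left hd1 hJ0,
    mul_nonneg hx hx]

/-- **Mass lower bound `(C1)`.**  For normalised (`n₆ = 1`) real class data — `n₁, n₃, n₄, n₅ ≥ 0`,
`n₁ + n₄ + n₅ = 2` — satisfying the two defect inequalities `(Y*)`, `(X*)` at level `j ≥ 1`
(`log B = (j+1) log 2`), the numerator of `1 − t = ((j+1)(n₃ − n₁) + n₁ + n₅)/((j+1) n₃ + n₅)` is at
least `1/4`.  In particular `t < 1` for every member, and `t → 1` forces `(j+1) n₃ + n₅ → ∞`.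
Proof: `x log x ≥ x − 1` and `≥ −3/8` turn `(Y*)`, `(X*)` into linear constraints; what is left is a
polynomial inequality in `(j+1, n₄, n₅)` with `log 2`-coefficients, linear in `n₄` and checked at
`n₄ = 0, 2` (`A0`, `A2`). [cite: CoppersmithWinograd1990, §8]
[cite: AlmanDuanVassilevskaWilliamsXuXuZhou2025, §3.4] -/
theorem mass_lower (j : ℕ) (hj : 1 ≤ j) {n₁ n₃ n₄ n₅ : ℝ} (h₁ : 0 ≤ n₁) (h₃ : 0 ≤ n₃) (h₄ : 0 ≤ n₄)
    (h₅ : 0 ≤ n₅) (hz : n₁ + n₄ + n₅ = 2)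
    (hY : (n₃ + n₅ + 1) * Real.log (n₃ + n₅ + 1) + n₄ * Real.log n₄ - 2 * Real.log 2 ≤
      (n₃ - n₁) * (((j : ℝ) + 1) * Real.log 2 + 1))
    (hX : (n₁ + n₃) * Real.log (n₁ + n₃) + n₅ * Real.log n₅ - 2 * Real.log 2 ≤
      (n₃ - n₄ - 1) * (((j : ℝ) + 1) * Real.log 2 + 1)) :
    1 / 4 ≤ ((j : ℝ) + 1) * (n₃ - n₁) + n₁ + n₅ := by
  set ℓ : ℝ := Real.log 2 with hℓdef
  set J : ℝ := (j : ℝ) + 1 with hJdef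
  have hl := Real.log_two_gt_d9
  have hl' := Real.log_two_lt_d9
  have hJ2 : 2 ≤ J := by
    have : (1 : ℝ) ≤ j := by exact_mod_cast hj
    rw [hJdef]; linarith
  have hJ0 : 0 ≤ J := by linarith
  have hx : 0 ≤ J - 2 := by linarith
  have hL1 : 0 < J * ℓ + 1 := by positivity
  -- linearised defect inequalities
  have ta := mul_log_tangent one_pos (show 0 ≤ n₃ + n₅ + 1 by linarith)
  rw [Real.log_one, mul_zero, zero_add, zero_add, one_mul] at ta
  have e4 := mul_log_ge_neg h₄
  have e13 := mul_log_ge_neg (show 0 ≤ n₁ + n₃ by linarith)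
  have e5 := mul_log_ge_neg h₅
  have Y' : n₃ + n₅ - 3 / 8 - 2 * ℓ ≤ (n₃ - n₁) * (J * ℓ + 1) := by linarith
  have X' : (n₄ + 1) * (J * ℓ + 1) - 3 / 4 - 2 * ℓ ≤ n₃ * (J * ℓ + 1) := by linarith
  have s1 : J * (n₃ + n₅ - 3 / 8 - 2 * ℓ) ≤ J * ((n₃ - n₁) * (J * ℓ + 1)) :=
    mul_le_mul_of_nonneg_left Y' hJ0
  have s2 : J * ((n₄ + 1) * (J * ℓ + 1) - 3 / 4 - 2 * ℓ) ≤ J * (n₃ * (J * ℓ + 1)) :=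
    mul_le_mul_of_nonneg_left X' hJ0
  -- the two endpoint polynomials (n₄ = 2 and n₄ = 0)
  have A2 := massPoly_two hJ2 hl hl'
  have A0 := massPoly_zero hJ2 hl hl'
  have key : 0 ≤ J * ((n₄ + 1) * (J * ℓ + 1) - 3 / 4 - 2 * ℓ) + J * (J * ℓ + 1) * (n₅ - 3 / 8 - 2 * ℓ)
      + (7 / 4 - n₄) * (J * ℓ + 1) ^ 2 := by
    have e : J * ((n₄ + 1) * (J * ℓ + 1) - 3 / 4 - 2 * ℓ) + J * (J * ℓ + 1) * (n₅ - 3 / 8 - 2 * ℓ)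
        + (7 / 4 - n₄) * (J * ℓ + 1) ^ 2 =
        (1 - n₄ / 2) * (J * (J * ℓ + 1) * (5 / 8 - 2 * ℓ) - J * (3 / 4 + 2 * ℓ)
          + 7 / 4 * (J * ℓ + 1) ^ 2)
        + (n₄ / 2) * (J * (J * ℓ + 1) * (21 / 8 - 2 * ℓ) - J * (3 / 4 + 2 * ℓ)
          - 1 / 4 * (J * ℓ + 1) ^ 2)
        + J * (J * ℓ + 1) * n₅ := by ring
    rw [e]
    have h4' : n₄ ≤ 2 := by linarith
    exact add_nonneg (add_nonneg (mul_nonneg (by linarith) A0) (mul_nonneg (by linarith) A2))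
      (mul_nonneg (mul_nonneg hJ0 hL1.le) h₅)
  -- assemble
  have hfin : (J * ℓ + 1) ^ 2 * (1 / 4) ≤ (J * ℓ + 1) ^ 2 * (J * (n₃ - n₁) + n₁ + n₅) := by
    have e : (J * ℓ + 1) ^ 2 * (J * (n₃ - n₁) + n₁ + n₅) =
        (J * ℓ + 1) * (J * ((n₃ - n₁) * (J * ℓ + 1))) + (n₁ + n₅) * (J * ℓ + 1) ^ 2 := by ring
    rw [e, show n₁ + n₅ = 2 - n₄ by linarith]
    linarith [mul_le_mul_of_nonneg_left s1 hL1.le, s2, key]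
  exact le_of_mul_le_mul_left hfin (by positivity)


/-! ### §2  The in-class ceiling inequality `(C2)` -/

/-- `x log x ≤ x (x − 1)` for `x ≥ 0`. [folklore] -/
theorem mul_log_le {x : ℝ} (hx : 0 ≤ x) : x * Real.log x ≤ x * (x - 1) := by
  rcases eq_or_lt_of_le hx with h | h
  · rw [← h]; simp
  · exact mul_le_mul_of_nonneg_left (Real.log_le_sub_one_of_pos h) hx

/-- `log ρ ≤ 2` for `0 < ρ ≤ 4` (since `e² > 7`). [folklore] -/
theorem log_le_two {ρ : ℝ} (hρ : 0 < ρ) (hρ4 : ρ ≤ 4) : Real.log ρ ≤ 2 := by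
  rw [Real.log_le_iff_le_exp hρ, show (2 : ℝ) = 1 + 1 by norm_num, Real.exp_add]
  have := Real.exp_one_gt_d9
  nlinarith

/-- **In-class ceiling inequality `(C2)`.**  For normalised real class data at level `j ≥ 3`
(`n₁, n₃, n₄, n₅ ≥ 0`, `n₁ + n₄ + n₅ = 2`, defect inequalities `(Y*)`, `(X*)`) in the
regime `t ≥ 1/2` (i.e. `(j+1) n₃ + n₅ ≤ 2 j n₁`), the saturating pair
`t = j n₁ / ((j+1) n₃ + n₅)`, `r = ((j+1)(2^(j+1) − n₃) + n₁ + n₄)/((j+1) n₃ + n₅)` satisfies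
`(1 − t) · log r ≥ c₂ − 320/(j+1)` with `c₂ = (5 log(5/4) + 3 log 2)/3 = log θ_c`.
The constant `320` is absolute and not optimised.  Proof: `1 − t = M/D`, `log r ≥ log(2^j) − log(D/(j+1))`,
the defect inequality `(Y*)` transfers the mass `M` to the entropy side up to a bounded correction, and
the asymptotic `core` inequality supplies `c₂`. [cite: CoppersmithWinograd1990, §8]
[cite: AlmanDuanVassilevskaWilliamsXuXuZhou2025, §3.4] -/
theorem ceiling_ineq (j : ℕ) (hj : 3 ≤ j) {n₁ n₃ n₄ n₅ : ℝ} (h₁ : 0 ≤ n₁) (h₃ : 0 ≤ n₃)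
    (h₄ : 0 ≤ n₄) (h₅ : 0 ≤ n₅) (hz : n₁ + n₄ + n₅ = 2)
    (hY : (n₃ + n₅ + 1) * Real.log (n₃ + n₅ + 1) + n₄ * Real.log n₄ - 2 * Real.log 2 ≤
      (n₃ - n₁) * (((j : ℝ) + 1) * Real.log 2 + 1))
    (hX : (n₁ + n₃) * Real.log (n₁ + n₃) + n₅ * Real.log n₅ - 2 * Real.log 2 ≤
      (n₃ - n₄ - 1) * (((j : ℝ) + 1) * Real.log 2 + 1))
    (ht : ((j : ℝ) + 1) * n₃ + n₅ ≤ 2 * (j : ℝ) * n₁) :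
    (5 * Real.log (5 / 4) + 3 * Real.log 2) / 3 - 320 / ((j : ℝ) + 1) ≤
      (1 - (j : ℝ) * n₁ / (((j : ℝ) + 1) * n₃ + n₅)) *
        Real.log ((((j : ℝ) + 1) * ((2 : ℝ) ^ (j + 1) - n₃) + n₁ + n₄) /
          (((j : ℝ) + 1) * n₃ + n₅)) := by
  have hj1 : 1 ≤ j := le_trans (by norm_num) hj
  have hM := mass_lower j hj1 h₁ h₃ h₄ h₅ hz hY hX
  have hl := Real.log_two_gt_d9
  have hl' := Real.log_two_lt_d9
  set ℓ : ℝ := Real.log 2 with hℓdef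
  set J : ℝ := (j : ℝ) + 1 with hJdef
  set B : ℝ := (2 : ℝ) ^ (j + 1) with hBdef
  have hBlog : Real.log B = J * ℓ := by
    rw [hBdef, Real.log_pow]; push_cast; rw [hJdef, hℓdef]
  have hB16 : (16 : ℝ) ≤ B := by
    rw [hBdef]
    calc (16 : ℝ) = 2 ^ 4 := by norm_num
      _ ≤ 2 ^ (j + 1) := pow_le_pow_right₀ (by norm_num) (by omega)
  have hj3 : (3 : ℝ) ≤ j := by exact_mod_cast hj
  have hJ4 : 4 ≤ J := by rw [hJdef]; linarith only [hj3]
  have hjJ : (j : ℝ) = J - 1 := by rw [hJdef]; ring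
  clear_value ℓ J B
  have hm0 : 0 ≤ Real.log (5 / 4) := Real.log_nonneg (by norm_num)
  have hm1 : Real.log (5 / 4) ≤ 1 / 4 := by
    have := Real.log_le_sub_one_of_pos (show (0 : ℝ) < 5 / 4 by norm_num); linarith only [this]
  have hJ0 : 0 < J := by linarith only [hJ4]
  have hB0 : 0 < B := by linarith only [hB16]
  have hJℓ : 4 * ℓ ≤ J * ℓ := mul_le_mul_of_nonneg_right hJ4 (by linarith only [hl])
  have hJℓ' : J * 0.6931471803 ≤ J * ℓ := mul_le_mul_of_nonneg_left hl.le hJ0.le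
  have hL1 : 0 < J * ℓ + 1 := by linarith only [hJℓ', hJ4]
  -- linearised defect inequalities
  have ta := mul_log_tangent one_pos (show 0 ≤ n₃ + n₅ + 1 by linarith only [h₃, h₅])
  rw [Real.log_one, mul_zero, zero_add, zero_add, one_mul] at ta
  have e4 := mul_log_ge_neg h₄
  have e13 := mul_log_ge_neg (show 0 ≤ n₁ + n₃ by linarith only [h₁, h₃])
  have e5 := mul_log_ge_neg h₅
  have Y' : n₃ + n₅ - 3 / 8 - 2 * ℓ ≤ (n₃ - n₁) * (J * ℓ + 1) := by linarith only [hY, ta, e4]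
  have X' : (n₄ + 1) * (J * ℓ + 1) - 3 / 4 - 2 * ℓ ≤ n₃ * (J * ℓ + 1) := by
    linarith only [hX, e13, e5]
  have p4 : 0 ≤ n₄ * (J * ℓ + 1) := mul_nonneg h₄ hL1.le
  -- a priori bounds in the regime
  have hn3l : 43 / 100 ≤ n₃ := by
    rcases le_or_gt 1 n₃ with h | h
    · linarith only [h]
    · have q1 : (1 - n₃) * (4 * ℓ + 1) ≤ (1 - n₃) * (J * ℓ + 1) :=
        mul_le_mul_of_nonneg_left (by linarith only [hJℓ]) (by linarith only [h])
      have q2 : (1 - n₃) * (37724 / 10000) ≤ (1 - n₃) * (4 * ℓ + 1) :=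
        mul_le_mul_of_nonneg_left (by linarith only [hl]) (by linarith only [h])
      linarith only [q1, q2, X', p4, hl', h]
  have hn3u' : J * n₃ ≤ J * (2 * n₁) := by
    rw [hjJ] at ht; linarith only [ht, h₁, h₅]
  have hn3u : n₃ ≤ 2 * n₁ := le_of_mul_le_mul_left hn3u' hJ0
  have ha5 : n₃ + n₅ + 1 ≤ 5 := by linarith only [hn3u, hz, h₄, h₅]
  have hDl : 43 / 100 * J ≤ J * n₃ + n₅ := by
    have := mul_le_mul_of_nonneg_left hn3l hJ0.le; linarith only [this, h₅]
  have hD0 : 0 < J * n₃ + n₅ := by linarith only [hDl, hJ4]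
  have hDu : J * n₃ + n₅ ≤ 4 * J := by
    have q1 : 0 ≤ J * n₄ := mul_nonneg hJ0.le h₄
    have q2 : 0 ≤ J * n₅ := mul_nonneg hJ0.le h₅
    have q3 : J * (2 * n₁) = 4 * J - 2 * (J * n₄) - 2 * (J * n₅) := by
      rw [show 2 * n₁ = 4 - 2 * n₄ - 2 * n₅ by linarith only [hz]]; ring
    have q4 : n₅ ≤ J * n₅ := le_mul_of_one_le_left h₅ (by linarith only [hJ4])
    linarith only [hn3u', q1, q2, q3, q4]
  set D : ℝ := J * n₃ + n₅ with hDdef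
  clear_value D
  have hDne : D ≠ 0 := hD0.ne'
  set ρ : ℝ := D / J with hρdef
  clear_value ρ
  have hρ0 : 0 < ρ := by rw [hρdef]; exact div_pos hD0 hJ0
  have hρl : 43 / 100 ≤ ρ := by rw [hρdef, le_div_iff₀ hJ0]; linarith only [hDl]
  have hρu : ρ ≤ 4 := by rw [hρdef, div_le_iff₀ hJ0]; linarith only [hDu]
  have hlogρ : Real.log ρ ≤ 2 := log_le_two hρ0 hρu
  have hlogρl : -(133 / 100) ≤ Real.log ρ := by
    have i1 := Real.one_sub_inv_le_log_of_pos hρ0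
    have i2 : ρ⁻¹ ≤ 1 / (43 / 100) := by
      rw [inv_eq_one_div]; exact one_div_le_one_div_of_le (by norm_num) hρl
    linarith only [i1, i2]
  set σ : ℝ := 1 + ℓ + Real.log ρ with hσdef
  set P : ℝ := J * ℓ + 1 - σ with hPdef
  clear_value σ P
  have hσ0 : 0 ≤ σ := by linarith only [hσdef, hl, hlogρl]
  have hσu : σ ≤ 37 / 10 := by linarith only [hσdef, hl', hlogρ]
  have hP0 : 0 < P := by linarith only [hPdef, hσdef, hJℓ, hl, hlogρ]
  -- mass and `1 - t`
  set M : ℝ := J * (n₃ - n₁) + n₁ + n₅ with hMdef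
  clear_value M
  have hM0 : 0 ≤ M := by linarith only [hM]
  have e1t : 1 - (j : ℝ) * n₁ / D = M / D := by
    rw [eq_div_iff hDne, sub_mul, div_mul_cancel₀ _ hDne, hjJ, hMdef, hDdef]; ring
  -- log r ≥ P
  have hNr : J * B / 2 ≤ J * (B - n₃) + n₁ + n₄ := by
    have := mul_nonneg hJ0.le (show 0 ≤ B / 2 - n₃ by linarith only [hB16, hn3u, hz, h₄, h₅])
    linarith only [this, h₁, h₄]
  have hJB2 : 0 < J * B / 2 := div_pos (mul_pos hJ0 hB0) two_pos
  have hNr0 : 0 < J * (B - n₃) + n₁ + n₄ := by linarith only [hNr, hJB2]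
  have hlogr : P ≤ Real.log ((J * (B - n₃) + n₁ + n₄) / D) := by
    have e : Real.log (J * B / 2 / D) = P := by
      rw [hPdef, hσdef, hρdef, Real.log_div hJB2.ne' hDne,
        Real.log_div (mul_pos hJ0 hB0).ne' (by norm_num), Real.log_mul hJ0.ne' hB0.ne', hBlog,
        Real.log_div hDne hJ0.ne', ← hℓdef]
      ring
    rw [← e]
    exact Real.log_le_log (div_pos hJB2 hD0) (div_le_div_of_nonneg_right hNr hD0.le)
  -- the core estimate: c₂ D - 136 ≤ M * P
  set Ψ : ℝ := (n₃ + n₅ + 1) * Real.log (n₃ + n₅ + 1) + n₄ * Real.log n₄ - 2 * ℓ with hΨdef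
  set ε : ℝ := (3 / 4 + 2 * ℓ) / (J * ℓ + 1) with hεdef
  clear_value Ψ ε
  have hε0 : 0 ≤ ε := by rw [hεdef]; exact div_nonneg (by linarith only [hl]) hL1.le
  have hA : n₁ ≤ n₃ + ε := by
    rw [hεdef, ← sub_le_iff_le_add', le_div_iff₀ hL1]; linarith only [Y', h₃, h₅, hl]
  have hB' : n₄ + 1 ≤ n₃ + ε := by
    rw [hεdef, ← sub_le_iff_le_add', le_div_iff₀ hL1]; linarith only [X']
  have hcore := core h₃ h₄ h₅ hε0 hz hA hB'
  have hJε : J * ε ≤ 309 / 100 := by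
    rw [hεdef, ← mul_div_assoc, div_le_iff₀ hL1]; linarith only [hJℓ', hJ0]
  set c₂ : ℝ := (5 * Real.log (5 / 4) + 3 * ℓ) / 3 with hc₂def
  clear_value c₂
  have hc₂u : c₂ ≤ 111 / 100 := by rw [hc₂def]; linarith only [hm1, hl']
  have hc₂0 : 0 ≤ c₂ := by rw [hc₂def]; linarith only [hm0, hl]
  rw [← hℓdef, ← hc₂def] at hcore
  set W : ℝ := J * Ψ + (n₁ + n₅) * (J * ℓ + 1) with hWdef
  clear_value W
  have hW : c₂ * D - 11 / 2 ≤ W := by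
    have h0 : c₂ * n₃ ≤ Ψ + (n₁ + n₅) * ℓ + ε := by linarith only [hcore, hΨdef]
    have h1 : J * (c₂ * n₃) ≤ J * (Ψ + (n₁ + n₅) * ℓ + ε) := mul_le_mul_of_nonneg_left h0 hJ0.le
    have h2 : c₂ * n₅ ≤ 111 / 100 * 2 :=
      mul_le_mul hc₂u (by linarith only [hz, h₁, h₄]) h₅ (by norm_num)
    have eD : c₂ * D = J * (c₂ * n₃) + c₂ * n₅ := by rw [hDdef]; ring
    linarith only [hWdef, h1, h2, h₁, h₅, eD, hJε]
  -- correction term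
  have hΨl : 0 ≤ Ψ + 3 / 8 + 2 * ℓ := by linarith only [hΨdef, ta, e4, h₃, h₅]
  have hΨu : Ψ + 3 / 8 + 2 * ℓ ≤ 112 / 5 := by
    have f1 := mul_log_le (show 0 ≤ n₃ + n₅ + 1 by linarith only [h₃, h₅])
    have f2 := mul_log_le h₄
    have g1 := mul_nonneg (show 0 ≤ 5 - (n₃ + n₅ + 1) by linarith only [ha5])
      (show 0 ≤ n₃ + n₅ + 1 + 4 by linarith only [h₃, h₅])
    have g2 := mul_nonneg (show 0 ≤ 2 - n₄ by linarith only [hz, h₁, h₅])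
      (show 0 ≤ n₄ + 1 by linarith only [h₄])
    linarith only [hΨdef, f1, f2, g1, g2]
  set W' : ℝ := J * (Ψ + 3 / 8 + 2 * ℓ) + (n₁ + n₅) * (J * ℓ + 1) with hW'def
  clear_value W'
  have hW'0 : 0 ≤ W' := by
    have := add_nonneg (mul_nonneg hJ0.le hΨl)
      (mul_nonneg (show 0 ≤ n₁ + n₅ by linarith only [h₁, h₅]) hL1.le)
    linarith only [hW'def, this]
  have hcorr : W' * σ ≤ 130 * (J * ℓ + 1) := by
    have c1 : W' * σ ≤ W' * (37 / 10) := mul_le_mul_of_nonneg_left hσu hW'0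
    have c2 : W' ≤ J * (112 / 5) + 2 * (J * ℓ + 1) := by
      have d1 := mul_le_mul_of_nonneg_left hΨu hJ0.le
      have d2 : (n₁ + n₅) * (J * ℓ + 1) ≤ 2 * (J * ℓ + 1) :=
        mul_le_mul_of_nonneg_right (by linarith only [hz, h₄]) hL1.le
      linarith only [hW'def, d1, d2]
    linarith only [c1, c2, hJℓ', hJ0]
  have hMP1 : (J * ℓ + 1) * W - W' * σ ≤ (J * ℓ + 1) * (M * P) := by
    have p1 : 0 ≤ J * ((n₃ - n₁) * (J * ℓ + 1) - Ψ) * P :=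
      mul_nonneg (mul_nonneg hJ0.le (by linarith only [hY])) hP0.le
    have p2 : 0 ≤ J * (3 / 8 + 2 * ℓ) * σ :=
      mul_nonneg (mul_nonneg hJ0.le (by linarith only [hl])) hσ0
    have e : (J * ℓ + 1) * (M * P) - ((J * ℓ + 1) * W - W' * σ) =
        J * ((n₃ - n₁) * (J * ℓ + 1) - Ψ) * P + J * (3 / 8 + 2 * ℓ) * σ := by
      rw [hMdef, hWdef, hW'def, hPdef]; ring
    linarith only [e, p1, p2]
  have hMP : c₂ * D - 136 ≤ M * P := by
    have q := mul_le_mul_of_nonneg_left hW hL1.le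
    have : (J * ℓ + 1) * (c₂ * D - 136) ≤ (J * ℓ + 1) * (M * P) := by
      linarith only [q, hMP1, hcorr, hL1]
    exact le_of_mul_le_mul_left this hL1
  -- assemble
  have hK : 136 / D ≤ 320 / J := by
    rw [div_le_div_iff₀ hD0 hJ0]; linarith only [hDl, hJ4]
  calc c₂ - 320 / J ≤ c₂ - 136 / D := by linarith only [hK]
    _ = (c₂ * D - 136) / D := by field_simp
    _ ≤ (M * P) / D := div_le_div_of_nonneg_right hMP hD0.le
    _ = (M / D) * P := by ring
    _ ≤ (M / D) * Real.log ((J * (B - n₃) + n₁ + n₄) / D) :=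
        mul_le_mul_of_nonneg_left hlogr (div_nonneg hM0 hD0.le)
    _ = _ := by rw [e1t]

end Summit.MatrixMultiplication.MatrixMultiplication.Theorems.SaturationLadderTwinClassCeiling
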